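/-
Copyright: the b2b-balaban cell (near-miss cell 7), T⁴-continuum CRUX team (coordinator ruling e34b3e0c item (2)),
row NE7b, seat t4-ne7b-formalise-leaf-01 (gen 77) for the OWNER lineage `t4-ne7b-p1`'s IR-103-2 «count DERIVED»
(memo `t4/b2b-balaban-t4-ne7b-p1/g103/F-RHO-TOWER-g103.md` §7 REFINED, journal [NE7bP1-G103-IR1032-L1]; the END (B, label-guarded) of the tower's P∕W∕T chain — the END the tower road of record consumes).
Released under the licence of the surrounding project.
-/
import Summits.QuantumFields.BalabanUV.T4Continuum.Spine.NE7b.RealisedEndRelPWT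
import Summits.QuantumFields.BalabanUV.T4Continuum.Support.HistoryRealiseCellsRunMultEndPDWTL

/-!
# Realised histories: END-B (label-guarded) of the P∕W∕T chain RE-CUT at the RELATIVE member-key display (IR-103-2)

Crux-route work under `Spine/NE7b/` of the T⁴-continuum cell (rung (B)+1 on a FINITE torus only; NOT infinite volume, NOT the
mass gap, NOT the Clay statement; NOT a proof of the spine estimate NE7b — `T4WeightBudget.RelWeightBound`, the cell's
OWN estimate, NOT PRINTED, NOT PROVED).

WHY.  The road of record AT THE TOWER (2R ∕ IR-102-2: `B16HistoryTowerEnd…LWRP82(R)` → `HistoryRealiseCellsRunAssemblyWTVSL(W)…`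
→ `…HeadlineT3bPWTVSL` → `…PinnedT3bPWTL` → `…MultEndPDWTL` → `…MultEndPWT` → `…MultPWT` → `HistoryAssemblyRealiseRunMultPWT`
→ `HistoryAssemblyRealiseMult.hybridNE7_of_termReadingLE_mult`) runs through the PROFILE-level (`P`), MEMORY-AGNOSTIC (`W`),
TOTAL-cost (`T`) variants of the multiplicity-socket levels, not through `HistoryAssemblyRealiseRunMult` ∕
`HistoryRealiseCellsRunMult(End)`.  The OWNER re-cut the count exit at the RELATIVE class display (IR-103-0
`TreeBindersRel`, IR-103-2 level 1 `TermReadingRel`, levels 3∕4 `RealisedRunRel` over the plain reading); THIS FILE is the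
`_rel` twin of the END (B) `HistoryRealiseCellsRunMultEndPDWTL.hybridNE7_of_realisedDomainsRunW_printedT3bPDTL` — THE END the tower road consumes (`HistoryRealiseCellsRunPinnedT3bPWTL` imports it) of THAT tower chain, so that a «count DERIVED» END at the tower (`B16HistoryTowerExtractionEnd2`,
memo §7 REFINED) finds the same socket it used before the re-cut, minus the (B)-side rows, the envelopes and the term-wise
numerator rows — replaced by `hA0 hA0′`, one RELATIVE quotient `qA ∕ qB` per physical member-key family (`hqA ∕ hqB`), THE
TWO RELATIVE DISPLAYS `fibM ∕ fibM′` and the price sentences `hPq ∕ hPq′` at that quotient; conclusion constant `1`.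
[folklore] COMPOSITION BY NAME; no definition, no `Prop` of Bałaban's minted, no `[cite:]` tag, zero `sorry`.

WHAT.  **`hybridNE7_of_realisedDomainsRunW_printedT3bPDTL_rel`** = the previous file's END-A twin with `hdis` DISCHARGED from the displayed
reading clauses `hDJ : DisjointJoinsL …` (label-guarded) and `hBB : BoxedBirths …` by `HistoryAssemblyMultInstanceWL.hdisV_of_domainsRWL`
exactly as the original.  Binder diff against the original: GONE = {(B) rows, envelopes, `FcM RfM FcM′ RfM′`, `hPM hPM′`, term-wise
rows}; NEW = {`hA0 hA0′ qA qB hqA hqB fibM fibM′ hPq hPq′`}; conclusion constant `1`.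

WHAT REMAINS DISPLAYED (census).  CONSTANTS: `ThresholdOK`, `0 < C.μ`, the κ₁∕E₀ largeness, the profile level `P` with
`hP1 ∕ hP`, the slack `C.a + θ ≤ ½γ₀A₁²`, partner letters, the signs `0 < E₂`, `0 ≤ E₃`, `sS`, `θc` + side conditions, `θ` above the instance's constant.  FLOW (⇐ BetaPertH, displayed): box β-bounds,
`SmallnessFor`, `β₀ ≤ ½`, tuning, IR smallness, the (2.5) side condition.  H3: the MEMORY-AGNOSTIC reading `RealisedDomainsRW` +
side conditions, `phys`, the realised LIFE costs in TOTAL form (`hκ ∕ hκ′`), `hstep`, `hDJ` (label-guarded) ∕ `hBB`, `hqA ∕ hqB`, the price sentences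
`hPq ∕ hPq′`, and **the two RELATIVE displays `fibM ∕ fibM′`** (for Bałaban's tower: print's KIND, [Balaban1989LargeFieldII]
(1.79)–(1.89) with the pinned genealogy's operations bounded, RELATIVE; NOT in print — the row's wall H3^NE7b at
partial-sum level).  SEAM: `ShellWeightBound`, `ReindexedBudget`, four summable rates.  NO (B)-side input at this level (it
re-enters only at the headline, for the full sums' positivity and the source tilt).  BY-NAME EFFECT ON THE WALL: NONE.
NE7b NOT PRINTED ∕ NOT PROVED; spine PROVED 0∕9; rung (B)+1 on a FINITE torus — NOT infinite volume, NOT the mass gap,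
NOT Clay.
HONEST DEPENDENCY (cell): continuum YM on T⁴ ⇐ BetaPertH ∧ nine spine estimates (0/9 proved); BetaPertH ⇐ (D1) ∧ (D4)
∧ CAP+tail; G-an2-4 gates asym, D1 and NE2/3/4.  This file changes none of it.
-/

open Finset MeasureTheory
open Literature.MathematicalPhysics.QuantumFieldTheory.Balaban1983to89
open T4PersistenceDictionary T4PersistentHistoryCount T4BankedInduction T4PrintedShapeBanking
open T4WeightBudget T4GlobalDenominator T4LiveClassFibration T4LiveStructureGas T4LiveGasToTerms T4RecordPriceSeam
open T4PartnerMultiplicity T4IndicatorShell T4MatchingAssembly T4MatchingClosure T4MatchingClosureSocket T4Continuum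
open T4StabilitySocket T4BranchingRecordsGas T4TaggedShapeBanking T4CanonicalMenus T4RenewalChains
open Summit.QuantumFields.BalabanUV.T4Continuum.PlacementBatch
open Summit.QuantumFields.BalabanUV.T4Continuum.PlacementSkeleton
open Summit.QuantumFields.BalabanUV.T4Continuum.CountThresholdUniform
open Summit.QuantumFields.BalabanUV.T4Continuum.CountThresholdExit
open Summit.QuantumFields.BalabanUV.T4Continuum.CountSeamJunction
open Summit.QuantumFields.BalabanUV.T4Continuum.LateMergers
open Summit.QuantumFields.BalabanUV.T4Continuum.HistoryFlow
open Summit.QuantumFields.BalabanUV.T4Continuum.HistoryRegeneration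
open Summit.QuantumFields.BalabanUV.T4Continuum.HistoryTables
open Summit.QuantumFields.BalabanUV.T4Continuum.HistoryAssemblyTrees
open Summit.QuantumFields.BalabanUV.T4Continuum.HistoryAssemblyTerms
open Summit.QuantumFields.BalabanUV.T4Continuum.HistoryAssemblyPedigree
open Summit.QuantumFields.BalabanUV.T4Continuum.HistoryConstants
open Summit.QuantumFields.BalabanUV.T4Continuum.HistoryGen
open Literature.MathematicalPhysics.QuantumFieldTheory.Balaban1983to89.B13ScaleTransfer
open Summit.QuantumFields.BalabanUV.T4Continuum.ZoneSkeleton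
open Summit.QuantumFields.BalabanUV.T4Continuum.HistorySocketTH
open Summit.QuantumFields.BalabanUV.T4Continuum.HistoryCaps
open Summit.QuantumFields.BalabanUV.T4Continuum.HistoryAssemblyPrice
open Summit.QuantumFields.BalabanUV.T4Continuum.HistoryBankingLE
open Summit.QuantumFields.BalabanUV.T4Continuum.HistoryExitLE
open Summit.QuantumFields.BalabanUV.T4Continuum.HistoryAssemblyTreesLE
open Summit.QuantumFields.BalabanUV.T4Continuum.HistoryAssemblyTermsLE
open Summit.QuantumFields.BalabanUV.T4Continuum.HistoryRealise
open Summit.QuantumFields.BalabanUV.T4Continuum.HistoryAssemblyRealiseLE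
open Summit.QuantumFields.BalabanUV.T4Continuum.HistoryAssemblyMult
open Summit.QuantumFields.BalabanUV.T4Continuum.HistoryAssemblyMultKey
open Summit.QuantumFields.BalabanUV.T4Continuum.HistoryAssemblyRealiseRun
open Summit.QuantumFields.BalabanUV.T4Continuum.HistoryAssemblyRealiseMult
open Summit.QuantumFields.BalabanUV.T4Continuum.HistoryZones
open Summit.QuantumFields.BalabanUV.T4Continuum.HistoryRealiseCells
open Summit.QuantumFields.BalabanUV.T4Continuum.HistoryRealiseCellsRun
open Summit.QuantumFields.BalabanUV.T4Continuum.HistoryAssemblyRealiseRunMult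
open Summit.QuantumFields.BalabanUV.T4Continuum.HistoryRealiseCellsRunMult
open Summit.QuantumFields.BalabanUV.T4Continuum.HistoryAssemblyMultInstance
open Summit.QuantumFields.BalabanUV.T4Continuum.HistoryJoinsPlacedMember
open Summit.QuantumFields.BalabanUV.T4Continuum.PlacementSkeleton
open Summit.QuantumFields.BalabanUV.T4Continuum.HistoryJoinsPlacedMult
open Summit.QuantumFields.BalabanUV.T4Continuum.HistoryRealiseDistinct
open Summit.QuantumFields.BalabanUV.T4Continuum.HistoryRegionTemplates
open Summit.QuantumFields.BalabanUV.T4Continuum.HistoryCaps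
open Summit.QuantumFields.BalabanUV.T4Continuum.HistoryZoneEvolve (cth)
open Literature.MathematicalPhysics.QuantumFieldTheory.Balaban1983to89.B16SProfile (DropCtl)
open Summit.QuantumFields.BalabanUV.T4Continuum.HistoryRealiseCellsRunMultEnd
open Summit.QuantumFields.BalabanUV.T4Continuum.HistoryRealiseCellsRunMultP
open Summit.QuantumFields.BalabanUV.T4Continuum.HistoryRealiseCellsRunMultEndP
open Summit.QuantumFields.BalabanUV.T4Continuum.HistoryRealisePrint
open Summit.QuantumFields.BalabanUV.T4Continuum.HistoryRealiseWeak
open Summit.QuantumFields.BalabanUV.T4Continuum.HistoryRealiseWeakReading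
open Summit.QuantumFields.BalabanUV.T4Continuum.HistoryRealiseWeakCells
open Summit.QuantumFields.BalabanUV.T4Continuum.HistoryAssemblyRealiseRunMultW
open Summit.QuantumFields.BalabanUV.T4Continuum.HistoryAssemblyRealiseRunMultPWT
open Summit.QuantumFields.BalabanUV.T4Continuum.HistoryAssemblyMultInstanceW
open Summit.QuantumFields.BalabanUV.T4Continuum.HistoryRealiseCellsRunMultW
open Summit.QuantumFields.BalabanUV.T4Continuum.HistoryRealiseCellsRunMultPWT
open Summit.QuantumFields.BalabanUV.T4Continuum.HistoryRealiseCellsRunMultEndW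
open Summit.QuantumFields.BalabanUV.T4Continuum.HistoryRealiseCellsRunMultEndDW
open Summit.QuantumFields.BalabanUV.T4Continuum.HistoryRealiseCellsRunMultEndPWT
open Summit.QuantumFields.BalabanUV.T4Continuum.HistoryRealiseCellsRunMultEndPD
open Summit.QuantumFields.BalabanUV.T4Continuum.HistoryRealiseDistinctGuarded
open Summit.QuantumFields.BalabanUV.T4Continuum.HistoryAssemblyMultInstanceWL
open Summit.QuantumFields.BalabanUV.T4Continuum.NE7b.RealisedEndRelPWT
open Summit.QuantumFields.BalabanUV.T4Continuum.HistoryRealiseCellsRunMultEndPDWTL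

namespace Summit.QuantumFields.BalabanUV.T4Continuum.NE7b.RealisedEndRelPDWTL

noncomputable section

section End

variable {F : T4Family} {G : Type*} [GaugeGroup G] [MeasurableSpace G] [HaarData G]
variable {α π : Type*} [DecidableEq α] [DecidableEq π]
variable {ι : Type*} [DecidableEq ι] {l₀ vol : ℝ} {K₀ : ℕ} {T : ℕ → Finset ι} {A A' shA shB : ℕ → ℝ → ι → ℝ}
  {Cc Rr CcRec RrRec : ℕ → ℝ → ι → ℝ} {ν u s₂ q₀ r s Wsh : ℕ → ℝ}

/-- **NE7b's COUNT EXIT — END-B (P∕W∕T, LABEL-GUARDED): AS END-A's TWIN WITH `hdis` DISCHARGED FROM `DisjointJoinsL` ∕ `BoxedBirths`, THE NUMERATOR READ AS TWO RELATIVE DISPLAYS** (the `_rel` twin of `HistoryRealiseCellsRunMultEndPDWTL.hybridNE7_of_realisedDomainsRunW_printedT3bPDTL`, IR-103-2 «count DERIVED»,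
crux lane `Spine/NE7b/`): the SAME statement with the (B)-side rows, the envelopes `nup ∕ mup ≤ Nup` and the term-wise
numerator rows `upM ∕ deadM_nonneg ∕ resumM ∕ FM_nonneg` (both runs) GONE, replaced by the non-negativity of the weights on
`T K` (`hA0 ∕ hA0′`), ONE RELATIVE quotient `qA ∕ qB` per physical member-key family, non-negative on the bad families
(`hqA ∕ hqB`), THE TWO RELATIVE DISPLAYS `fibM ∕ fibM′` («the partial sum over the histories with the same physical live
data is at most the family's quotient times the FULL sum») and the price sentences `hPq ∕ hPq′` in PRINT's currency at that
quotient; conclusion with envelope constant `1`.  Proof = the original's, line for line, over `hybridNE7_of_realisedDomainsRunW_printedT3bPT_rel`.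
[folklore] -/
theorem hybridNE7_of_realisedDomainsRunW_printedT3bPDTL_rel (D : FiniteEpsData F G) {C : T4PrintedShapeBanking.Consts}
    {O : PrintedO1s}
    {rr : ℕ} {β₀ : ℝ} (h : ThresholdOK C F.L rr β₀) (hμ : 0 < C.μ) (d n : ℕ)
    (hκ₁ : (d : ℝ) * Real.log F.L + 2 * Real.log 2 ≤ C.κ₁) (hE₀ : Real.log (2 + birthMass C) ≤ C.E₀)
    -- the flow side (⇐ BetaPertH, displayed) and tuning
    {γ₀ γb b β' : ℝ} {pe : ℕ} (hb : 0 ≤ b) (hlo : FlowStep.BetaLowerH b γ₀ D.βfun)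
    (hhi : FlowStep.BetaUpperH β' γ₀ D.βfun) (hγ : γb ≤ γ₀) (hγβ : γb ^ 2 * β' < 1)
    (S : B14FlowStep.SmallnessFor γb β' β₀ F.L pe) (hp₀ : C.p₀ ≤ pe) (hrr : rr ≤ pe) (hβ : β₀ ≤ 1 / 2)
    {g : ℝ} {g₀ : ℕ → ℝ} (ht : D.Tuned γb g g₀)
    (hir : irThresholdTLE C F.L rr β₀ ≤ Real.log (g ^ 2)⁻¹)
    -- row S12j: a displayed profile LEVEL `P ≥ 1` below `p₀(g_K(s))` along every run (in the pinned ∕ apex form it is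
    -- DISCHARGED from the infrared threshold: `p₀` at the threshold) — the class-linear slack is read AT THIS LEVEL
    {P : ℝ} (hP1 : 1 ≤ P)
    (hP : ∀ K, K₀ ≤ K → ∀ s, s ≤ K → P ≤ p0Profile C.A₀ C.p₀ ((D.C ⟨K, F.m, g₀ K⟩).flow.g s))
    -- the (2.5) side condition on the size function
    (R : ℕ → ℕ → ℕ) (hR : ∀ K s, s ≤ K → B14.IsRj F.L rr ((D.C ⟨K, F.m, g₀ K⟩).flow.g s) (R K s))
    -- the side conditions of the geometric lemmas (row S1b): torus side, window constant, sizes (NO drop control)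
    (hL4 : 4 ≤ F.L) (hn₁ : 13 ≤ C.n₁) (hR1 : ∀ K, K₀ ≤ K → ∀ t, 1 ≤ R K t)
    -- H3: the terms read as pedigrees REALISED BY THE RUN'S OWN PROFILE with their DOMAINS (root cells := `cellOfR`)
    (ped : ℕ → ι → Pedigree α π) (cellP : ℕ → ι → π → Pt d × Finset (Pt d)) (liveC : ℕ → ι → Finset α)
    (Zd : ℕ → ι → α → Finset (Pt d)) (H : RealisedDomainsRW F.L (runProfile F.L R) n K₀ R T ped cellP liveC Zd)
    (hn : 0 < n)
    -- H3: live components are dated no later than the cutoff; every live component's member has DISJOINT partners at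
    -- every join and BOXED constituents at their birth levels (row S1c-opt's reading clauses, leaf-08 gen 4)
    (hstep : ∀ K, K₀ ≤ K → ∀ τ ∈ T K, ∀ c ∈ liveC K τ, (ped K τ).step c ≤ K)
    (hDJ : ∀ K, K₀ ≤ K → ∀ τ ∈ T K, ∀ c ∈ liveC K τ, DisjointJoinsL ((ped K τ).toPGen (cellP K τ) c))
    (hBB : ∀ K, K₀ ≤ K → ∀ τ ∈ T K, ∀ c ∈ liveC K τ,
      BoxedBirths n F.L K (levelOf (runProfile F.L R K) K) ((ped K τ).toPGen (cellP K τ) c))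
    -- the class-linear slack: `C.a + θ ≤ ½γ₀A₁²` pays the factor `e^{θ·birthLinT}` of the slot multiplicity
    {θ : ℝ} (hθ : 0 ≤ θ) (hslack : C.a + θ ≤ O.γ₀ * O.A₁ ^ 2 / 2)
    -- row S6g′'s INSTANCE: the count's stride `sS` and decay `θc` with their arithmetic side conditions (symbolic), the
    -- signs of the floor ∕ size constants, and `θ·P` above the instance's class-linear constant (twin END at collar
    -- 32 + the root-template slope) — row S12j: the demand is on the coupling window, not on print's constants
    (hE₂ : 0 < C.E₂) (hE₃ : 0 ≤ C.E₃) {sS : ℕ} (hsS : 1 ≤ sS)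
    (hsmall : (((2 * cth 32 1 sS + 1) ^ d : ℕ) : ℝ) * (5 : ℝ) ^ d * ((max 1 (2 * 32 + 2) : ℕ) : ℝ) ≤
      (F.L : ℝ) ^ (sS / 2) / 2)
    {θc : ℝ} (hθc0 : 0 ≤ θc) (hθc1 : θc < 1) (hθcs : 1 / 2 ≤ θc ^ sS)
    (hθJ : (2 +
            ((2 * (((2 * cth 32 1 sS + 1) ^ d : ℕ) : ℝ) * ((((2 * 32 + 1) ^ d : ℕ) : ℝ) * (4 * 2 ^ d)) +
                  4 * ((((2 * cth 32 1 sS + 1) ^ d : ℕ) : ℝ) * (5 : ℝ) ^ d)) / (1 - θc) +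
              2 * (2 * ((((2 * cth 32 1 sS + 1) ^ d : ℕ) : ℝ) * (5 : ℝ) ^ d))) +
            (2 * ((0 + 2 * Real.log (2 * d + 1)) + (2 * (d : ℝ) + 2 * Real.log (2 * d + 1)) *
                  (((max 1 (2 * 32 + 2) : ℕ) : ℝ) * (2 * ((((2 * cth 32 1 sS + 1) ^ d : ℕ) : ℝ) * (5 : ℝ) ^ d)))) +
              (2 * (d : ℝ) + 2 * Real.log (2 * d + 1)) * 1 *
                (((max 1 (2 * 32 + 2) : ℕ) : ℝ) *
                    ((2 * (((2 * cth 32 1 sS + 1) ^ d : ℕ) : ℝ) * ((((2 * 32 + 1) ^ d : ℕ) : ℝ) * (4 * 2 ^ d)) +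
                        4 * ((((2 * cth 32 1 sS + 1) ^ d : ℕ) : ℝ) * (5 : ℝ) ^ d)) / (1 - θc)) +
                  4 * 2 ^ d)) +
            10) + 8 * 2 ^ d * Real.log (2 * d + 1) ≤ θ * P)
    -- H3: realised LIFE costs of the live members, read below the model's booked life cost — TOTAL form (R-OWNER-42-2)
    (κ κ' : ℕ → (Fin d → ℕ) × Gen (Lab α π) → Gen (Lab α π) → ℕ → ℝ)
    (hκ : ∀ K, K₀ ≤ K → ∀ τ ∈ badTerms (memOf ped liveC (cellOfR n F.L (runProfile F.L R) ped cellP)) jhalf T K, ∀ q ∈ memOf ped liveC (cellOfR n F.L (runProfile F.L R) ped cellP) K τ,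
      lifeCost (padW (dictWT Prod.fst (R K) C.n₁) 0) (κ K q) q.2 ≤
        lifeCost (padW (dictWT Prod.fst (R K) C.n₁) 0) (costT Prod.fst C K (R K)) q.2)
    (hκ' : ∀ K, K₀ ≤ K → ∀ τ ∈ badTerms (memOf ped liveC (cellOfR n F.L (runProfile F.L R) ped cellP)) jhalf T K, ∀ q ∈ memOf ped liveC (cellOfR n F.L (runProfile F.L R) ped cellP) K τ,
      lifeCost (padW (dictWT Prod.fst (R K) C.n₁) 0) (κ' K q) q.2 ≤
        lifeCost (padW (dictWT Prod.fst (R K) C.n₁) 0) (costT Prod.fst C K (R K)) q.2)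
    -- H3, RE-CUT (NO (B) side): non-negative weights; ONE RELATIVE DISPLAY PER PHYSICAL MEMBER-KEY FAMILY, both runs;
    -- the key quotients non-negative on the bad families and priced per term in PRINT's currency, discounted by the allowance
    (hA0 : ∀ K t, |t| ≤ l₀ → K₀ ≤ K → ∀ τ ∈ T K, 0 ≤ A K t τ)
    (hA0' : ∀ K t, |t| ≤ l₀ → K₀ ≤ K → ∀ τ ∈ T K, 0 ≤ A' K t τ)
    {qA qB : ℕ → Finset ((Fin d → ℕ) × Gen PEv × Multiset (PEv × ((Fin d → ℕ) × Finset (Pt d)))) → ℝ}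
    (hqA : ∀ K, K₀ ≤ K →
      ∀ k ∈ badGMems (memOf ped liveC (cellOfR n F.L (runProfile F.L R) ped cellP)) jhalf T (kmemOf ped liveC (cellOfR n F.L (runProfile F.L R) ped cellP) (physV n F.L hn (Nat.lt_of_lt_of_le Nat.zero_lt_two (two_le_L F))
        (fun K => tcap d (dcapOf Prod.fst T (memOf ped liveC (cellOfR n F.L (runProfile F.L R) ped cellP)) K))
        (fun K => one_le_tcap d (dcapOf Prod.fst T (memOf ped liveC (cellOfR n F.L (runProfile F.L R) ped cellP)) K)) (runProfile F.L R) ped cellP)) K, 0 ≤ qA K k)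
    (hqB : ∀ K, K₀ ≤ K →
      ∀ k ∈ badGMems (memOf ped liveC (cellOfR n F.L (runProfile F.L R) ped cellP)) jhalf T (kmemOf ped liveC (cellOfR n F.L (runProfile F.L R) ped cellP) (physV n F.L hn (Nat.lt_of_lt_of_le Nat.zero_lt_two (two_le_L F))
        (fun K => tcap d (dcapOf Prod.fst T (memOf ped liveC (cellOfR n F.L (runProfile F.L R) ped cellP)) K))
        (fun K => one_le_tcap d (dcapOf Prod.fst T (memOf ped liveC (cellOfR n F.L (runProfile F.L R) ped cellP)) K)) (runProfile F.L R) ped cellP)) K, 0 ≤ qB K k)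
    (fibM : ∀ K t, |t| ≤ l₀ → K₀ ≤ K →
      ∀ k ∈ badGMems (memOf ped liveC (cellOfR n F.L (runProfile F.L R) ped cellP)) jhalf T (kmemOf ped liveC (cellOfR n F.L (runProfile F.L R) ped cellP) (physV n F.L hn (Nat.lt_of_lt_of_le Nat.zero_lt_two (two_le_L F))
        (fun K => tcap d (dcapOf Prod.fst T (memOf ped liveC (cellOfR n F.L (runProfile F.L R) ped cellP)) K))
        (fun K => one_le_tcap d (dcapOf Prod.fst T (memOf ped liveC (cellOfR n F.L (runProfile F.L R) ped cellP)) K)) (runProfile F.L R) ped cellP)) K,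
        ∑ τ ∈ fibre (kmemOf ped liveC (cellOfR n F.L (runProfile F.L R) ped cellP) (physV n F.L hn (Nat.lt_of_lt_of_le Nat.zero_lt_two (two_le_L F))
        (fun K => tcap d (dcapOf Prod.fst T (memOf ped liveC (cellOfR n F.L (runProfile F.L R) ped cellP)) K))
        (fun K => one_le_tcap d (dcapOf Prod.fst T (memOf ped liveC (cellOfR n F.L (runProfile F.L R) ped cellP)) K)) (runProfile F.L R) ped cellP)) T K k, A K t τ ≤
          qA K k * ∑ σ ∈ T K, A K t σ)
    (fibM' : ∀ K t, |t| ≤ l₀ → K₀ ≤ K →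
      ∀ k ∈ badGMems (memOf ped liveC (cellOfR n F.L (runProfile F.L R) ped cellP)) jhalf T (kmemOf ped liveC (cellOfR n F.L (runProfile F.L R) ped cellP) (physV n F.L hn (Nat.lt_of_lt_of_le Nat.zero_lt_two (two_le_L F))
        (fun K => tcap d (dcapOf Prod.fst T (memOf ped liveC (cellOfR n F.L (runProfile F.L R) ped cellP)) K))
        (fun K => one_le_tcap d (dcapOf Prod.fst T (memOf ped liveC (cellOfR n F.L (runProfile F.L R) ped cellP)) K)) (runProfile F.L R) ped cellP)) K,
        ∑ τ ∈ fibre (kmemOf ped liveC (cellOfR n F.L (runProfile F.L R) ped cellP) (physV n F.L hn (Nat.lt_of_lt_of_le Nat.zero_lt_two (two_le_L F))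
        (fun K => tcap d (dcapOf Prod.fst T (memOf ped liveC (cellOfR n F.L (runProfile F.L R) ped cellP)) K))
        (fun K => one_le_tcap d (dcapOf Prod.fst T (memOf ped liveC (cellOfR n F.L (runProfile F.L R) ped cellP)) K)) (runProfile F.L R) ped cellP)) T K k, A' K t τ ≤
          qB K k * ∑ σ ∈ T K, A' K t σ)
    (hPq : ∀ K t, |t| ≤ l₀ → K₀ ≤ K → ∀ τ ∈ badTerms (memOf ped liveC (cellOfR n F.L (runProfile F.L R) ped cellP)) jhalf T K,
      qA K (kmemOf ped liveC (cellOfR n F.L (runProfile F.L R) ped cellP) (physV n F.L hn (Nat.lt_of_lt_of_le Nat.zero_lt_two (two_le_L F))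
        (fun K => tcap d (dcapOf Prod.fst T (memOf ped liveC (cellOfR n F.L (runProfile F.L R) ped cellP)) K))
        (fun K => one_le_tcap d (dcapOf Prod.fst T (memOf ped liveC (cellOfR n F.L (runProfile F.L R) ped cellP)) K)) (runProfile F.L R) ped cellP) K τ) ≤
        ∏ q ∈ memOf ped liveC (cellOfR n F.L (runProfile F.L R) ped cellP) K τ,
          pshapeTH Prod.fst O C 1 1 (R K) (D.C ⟨K, F.m, g₀ K⟩).flow.g 0 (κ K q) q.2 * Real.exp (-(8 / C.E₂ * totalCostT Prod.fst C K (R K) q.2 + 4 * (partnerAges (PEv.step ∘ Prod.fst) q.2 : ℝ))))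
    (hPq' : ∀ K t, |t| ≤ l₀ → K₀ ≤ K → ∀ τ ∈ badTerms (memOf ped liveC (cellOfR n F.L (runProfile F.L R) ped cellP)) jhalf T K,
      qB K (kmemOf ped liveC (cellOfR n F.L (runProfile F.L R) ped cellP) (physV n F.L hn (Nat.lt_of_lt_of_le Nat.zero_lt_two (two_le_L F))
        (fun K => tcap d (dcapOf Prod.fst T (memOf ped liveC (cellOfR n F.L (runProfile F.L R) ped cellP)) K))
        (fun K => one_le_tcap d (dcapOf Prod.fst T (memOf ped liveC (cellOfR n F.L (runProfile F.L R) ped cellP)) K)) (runProfile F.L R) ped cellP) K τ) ≤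
        ∏ q ∈ memOf ped liveC (cellOfR n F.L (runProfile F.L R) ped cellP) K τ,
          pshapeTH Prod.fst O C 1 1 (R K) (D.C ⟨K, F.m, g₀ K⟩).flow.g 0 (κ' K q) q.2 * Real.exp (-(8 / C.E₂ * totalCostT Prod.fst C K (R K) q.2 + 4 * (partnerAges (PEv.step ∘ Prod.fst) q.2 : ℝ))))
    -- the seam's other inputs
    (hSh : ShellWeightBound l₀ T A A' shA shB Wsh)
    (hTB : ReindexedBudget l₀ vol T (fun K t τ => A K t τ - shA K t τ) (fun K t τ => A' K t τ - shB K t τ)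
      (badOfClass (bstrOf Prod.fst (memOf ped liveC (cellOfR n F.L (runProfile F.L R) ped cellP))) T
        (fun K _ => badClasses Prod.fst (memOf ped liveC (cellOfR n F.L (runProfile F.L R) ped cellP)) jhalf T K)) Cc Rr CcRec RrRec ν u s₂ q₀ r s)
    (hr : Summable r) (hu : Summable u) (hs : Summable s) (hs₂ : Summable s₂) :
    ∃ K₁ K₂, K₀ ≤ K₁ ∧ HybridNE7 l₀ vol (fun K => T (K₁ + (K₂ + K))) (fun K => A (K₁ + (K₂ + K)))
      (fun K => A' (K₁ + (K₂ + K)))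
      (fun K => badOfClass (bstrOf Prod.fst (memOf ped liveC (cellOfR n F.L (runProfile F.L R) ped cellP))) T
        (fun K _ => badClasses Prod.fst (memOf ped liveC (cellOfR n F.L (runProfile F.L R) ped cellP)) jhalf T K) (K₁ + (K₂ + K)))
      (fun K => 1 * recordsBudget (birthMass C) C.κ₁ ((n : ℝ) ^ d) ((F.L : ℝ) ^ d) (Real.log 2) jhalf (K₁ + (K₂ + K)))
      (fun K => shA (K₁ + (K₂ + K))) (fun K => shB (K₁ + (K₂ + K))) (fun K => Wsh (K₁ + (K₂ + K)))
      (fun K => (r (K₁ + (K₂ + K)) + u (K₁ + (K₂ + K))) + (s (K₁ + (K₂ + K)) + s₂ (K₁ + (K₂ + K)))) := by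
  have hprof : ∀ K, K₀ ≤ K → ∀ t, t < K → runProfile F.L R K (t + 1) ≤ runProfile F.L R K t := fun K _ t htK =>
    runProfile_succ_le D hb hlo hhi hγ hγβ S ht R hR K t htK
  have hdropR : ∀ K, K₀ ≤ K → DropCtl (runProfile F.L R K) K := fun K _ =>
    dropCtl_runProfile D hb hlo hhi hγ hγβ S hrr hβ ht R hR K K
  have hMf : ∀ K, K₀ ≤ K → ∀ τ ∈ T K, ∀ c ∈ liveC K τ, ∀ bz ∈ ((ped K τ).toPGen (cellP K τ) c).pbirths,
      tcap d bz.1.fat ≤ (fun K => tcap d (dcapOf Prod.fst T (memOf ped liveC (cellOfR n F.L (runProfile F.L R) ped cellP)) K)) K :=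
    fun K hK τ hτ c hc bz hbz => tcap_mono d (le_of_lt (fat_lt_dcapOf_of_mem_pbirths
      (fun K hK τ hτ => H.renew_step K hK τ hτ) (cellOfR n F.L (runProfile F.L R) ped cellP) hK hτ hc hbz))
  exact hybridNE7_of_realisedDomainsRunW_printedT3bPT_rel D h hμ d n hκ₁ hE₀ hb hlo hhi hγ hγβ S hp₀ hrr hβ ht hir hP1 hP
     R hR hL4 hn₁ hR1 ped cellP liveC Zd H hn
    hstep
    (fun K hK τ hτ c hc => hdisV_of_domainsRWL (Nat.lt_of_lt_of_le Nat.zero_lt_two (two_le_L F)) hn (fun K => one_le_tcap d (dcapOf Prod.fst T (memOf ped liveC (cellOfR n F.L (runProfile F.L R) ped cellP)) K)) hprof hdropR H hDJ hBB hMf hK (mem_badTerms.1 hτ).1 hc)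
    hθ hslack hE₂ hE₃ hsS hsmall hθc0 hθc1 hθcs hθJ κ κ' hκ hκ'
    hA0 hA0' hqA hqB fibM fibM' hPq hPq' hSh hTB hr hu hs hs₂

end End

end

end Summit.QuantumFields.BalabanUV.T4Continuum.NE7b.RealisedEndRelPDWTL
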